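import Mathlib
import Summits.NavierStokesRegularity.NavierStokesRegularity.Theses.TypeIIInviscidRelaxation
import HarnessLib

/-!
# `TypeIIInviscidRelaxation.Assembly` — the route's assembly (item stmt-NavierStokesRegularity-1962;
  pure logic)

**Statement.** `TypeIICoreRelaxation → AxisymSwirlRegular → MonopoleCoreExclusion →
ColumnarCoreExclusion → NoTypeIBlowup → NoBlowupToClay → NavierStokesRegularity`.

PROOF. The route file `Theses/TypeIIInviscidRelaxation.lean` carries the planner-authored,
kernel-checked deciding theorem `Theses.TypeIIInviscidRelaxation.closes`, whose hypotheses are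
exactly the route's items and whose conclusion is the registered leaf; the assembly item is that
implication written as ONE proposition, so it is closed by applying `closes` to the hypotheses (here
`closes` is stated as the very same arrow chain).

HONEST FRAMING: glue between the route's own statements (about HYPOTHETICAL objects); nothing
here bears on the regularity problem itself.
-/

noncomputable section

set_option linter.dupNamespace false

namespace Summit.NavierStokesRegularity.NavierStokesRegularity.Theorems

open Summit.NavierStokesRegularity.NavierStokesRegularity.Theses.TypeIIInviscidRelaxation in
/-- **Item stmt-NavierStokesRegularity-1962** (`TypeIIInviscidRelaxation.Assembly`): the route's
chain of items implies its registered leaf, by the route file's deciding theorem `closes`. [this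
file] -/
theorem typeIIInviscidRelaxation_assembly_proof :
    Summit.NavierStokesRegularity.NavierStokesRegularity.Theses.TypeIIInviscidRelaxation.Assembly := by
  unfold Summit.NavierStokesRegularity.NavierStokesRegularity.Theses.TypeIIInviscidRelaxation.Assembly
  exact closes

end Summit.NavierStokesRegularity.NavierStokesRegularity.Theorems

end
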